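import Literature.NumberTheory.IwasawaTheory.CyclotomicTwoTotallyRamifiedOddIndex
import Literature.NumberTheory.EllipticCurves.ZpExtensionRestrictTwoSqrtTwo
import HarnessLib

/-!
# Fukuda's index is `0` for every cyclotomic `ℤ₂`-extension of a number field with `4 ∤ [K:ℚ]` whose primes above `2` have ODD
# ramification index (e.g. the `S₃`-sextics `ℚ(W[2])` of curves supersingular at `2`: degree `6`, `e = 3`)

Topic `Literature/NumberTheory/IwasawaTheory` (namespace = path).  THEOREMS ONLY (no definition, no named fact, no `sorry`), written by the
prover seat `bsd-wall-rtt-p4-w2` g20 (cell `bsd-wall`; `--supports` stmt-BirchSwinnertonDyer-21438, line `nonsquare-descent`; closes nothing;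
BSD is proved for no curve here).  Sequel of `CyclotomicTwoTotallyRamifiedOddIndex.lean` (there: `2 ∤ [K:ℚ]`), using the cell `bsd-2adic`'s
`ZpExtension.surjective_comp_absGaloisRestrict_of_forall_sq_ne_two` (`4 ∤ [L:ℚ]`, `√2 ∉ L` ⟹ `κ_cyc ∘ res` onto, `ZpExtensionRestrictTwoSqrtTwo.lean`).

* `forall_sq_ne_two_of_forall_odd_ramificationIdx` — if every prime of `K` above `2` has ODD `e(w|2)`, then `√2 ∉ K`
  (`√2 ∈ K` makes all `e(w|2)` even, tree `even_ramificationIdx_int_of_sq_eq_two`).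
* `exists_sq_eq_two_layer_one_of_forall_sq_ne_two` — `4 ∤ [K:ℚ]`, `√2 ∉ K`, `κ` cyclotomic ⟹ `√2 ∈ K₁ = κ.layer 1`.
* `not_isUnramifiedIn_layer_one_of_odd_ramificationIdx_of_not_four_dvd` — then a place `w ∣ 2` with odd `e(w|2)` ramifies in `K₁`.
* **`totallyRamifiedFrom_zero_of_forall_odd_ramificationIdx_of_not_four_dvd`** — `4 ∤ [K:ℚ]` and every `e(w|2)` odd ⟹ `TotallyRamifiedFrom κ 0`
  for every cyclotomic `ℤ₂`-extension `κ` of `K` (tree `totallyRamifiedFrom_zero_of_forall_not_isUnramifiedIn_layer_one`).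

The application to `M = ℚ(W[2])` (`[M:ℚ] = 6`, `e(𝔭|2) = 3`, tree `DivisionFieldTwoSupersingularUniquePrime`) is the sequel
`DivisionFieldTwoCyclotomicTowerNormKernel.lean`.

References: [Washington1997] §13.1 (`ℚ_1 = ℚ(√2)`, `L_n = L·ℚ_n`), Lemma 13.3; [Fukuda1994] p. 264; [NeukirchANT1999] Ch. I §8.
-/

noncomputable section

open scoped NumberField Pointwise
open Polynomial

namespace Literature.NumberTheory.IwasawaTheory

open Literature.NumberTheory.EllipticCurves Literature.NumberTheory.GaloisRepresentations Field
  IsDedekindDomain NumberField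


variable {K : Type} [Field K] [NumberField K]

omit [NumberField K] in
/-- A place of `K` containing `2` lies over `(2) ⊂ ℤ`. [folklore] -/
private theorem liesOver_span_two_of_mem' (w : HeightOneSpectrum (𝓞 K)) (hw : ((2 : ℕ) : 𝓞 K) ∈ w.asIdeal) :
    w.asIdeal.LiesOver (Ideal.span {(2 : ℤ)}) := by
  rw [Ideal.liesOver_span_iff w.isPrime.ne_top Int.prime_two, map_ofNat]
  exact_mod_cast hw

/-- **Odd ramification above `2` excludes `√2`.**  If every prime of `K` above `2` has ODD `e(w|2)`, then no element of `K` squares to `2`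
(if `θ² = 2` then every `e(w|2)` is even, tree `even_ramificationIdx_int_of_sq_eq_two`; and some prime of `K` lies above `2`).
[cite: NeukirchANT1999, Ch. I §8] [folklore] -/
theorem forall_sq_ne_two_of_forall_odd_ramificationIdx
    (hodd : ∀ w : HeightOneSpectrum (𝓞 K), ((2 : ℕ) : 𝓞 K) ∈ w.asIdeal → Odd (w.asIdeal.ramificationIdx ℤ)) :
    ∀ x : K, x ^ 2 ≠ 2 := by
  intro x hx
  haveI : (Ideal.span {(2 : ℤ)}).IsMaximal :=
    Ideal.IsPrime.isMaximal (Ideal.span_singleton_prime (by norm_num) |>.mpr Int.prime_two) (by simp)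
  obtain ⟨Q, hQmax, hQ⟩ := Ideal.exists_maximal_ideal_liesOver_of_isIntegral (S := 𝓞 K) (Ideal.span {(2 : ℤ)})
  haveI := hQmax
  haveI := hQ
  have hQ0 : Q ≠ ⊥ := Ring.ne_bot_of_isMaximal_of_not_isField hQmax (RingOfIntegers.not_isField K)
  have h2 : ((2 : ℕ) : 𝓞 K) ∈ Q := by
    have h := Ideal.mem_span_singleton_self (2 : ℤ)
    rw [hQ.over, Ideal.under_def, Ideal.mem_comap, map_ofNat] at h
    exact_mod_cast h
  have heven := even_ramificationIdx_int_of_sq_eq_two hx Q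
  exact (Nat.not_even_iff_odd.mpr (hodd ⟨Q, hQmax.isPrime, hQ0⟩ h2)) heven

/-- **`√2 ∈ K₁` when `4 ∤ [K:ℚ]` and `√2 ∉ K`.**  For such `K` and a cyclotomic `ℤ₂`-extension `κ` of `K`, the first layer `K₁ = κ.layer 1` contains
an element of square `2` (`K ∩ ℚ_∞ = ℚ`, so `κ` is a unit twist of `κ_cyc ∘ res`, whose layers contain the images of the `ℚ_n`, and `√2 ∈ ℚ_1`;
verbatim the tree's `exists_sq_eq_two_layer_one_of_not_dvd_finrank` with `surjective_comp_absGaloisRestrict_of_forall_sq_ne_two`).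
[cite: Washington1997, §13.1] -/
theorem exists_sq_eq_two_layer_one_of_forall_sq_ne_two (h4 : ¬ 4 ∣ Module.finrank ℚ K) (h2 : ∀ x : K, x ^ 2 ≠ 2)
    (κ : ZpExtension K 2) (hκ : κ.IsCyclotomic) : ∃ θ : κ.layer 1, θ ^ 2 = 2 := by
  have hsurj := ZpExtension.surjective_comp_absGaloisRestrict_of_forall_sq_ne_two
    (CyclotomicZp.zpExtension 2) K (CyclotomicZp.isCyclotomic_zpExtension 2) h4 h2
  have hcyc : ((CyclotomicZp.zpExtension 2).restrict K hsurj).IsCyclotomic :=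
    ZpExtension.isCyclotomic_restrict _ (CyclotomicZp.isCyclotomic_zpExtension 2) K hsurj
  obtain ⟨u, rfl⟩ := ZpExtension.IsCyclotomic.exists_eq_unitTwist_holds hcyc hκ
  obtain ⟨t, ht, ht2⟩ := CyclotomicZp.exists_mem_layer_one_sq_eq_two_zpExtension
  have hmem : absClosureEmbedding ℚ K t ∈
      (((CyclotomicZp.zpExtension 2).restrict K hsurj).unitTwist u).layer 1 := by
    rw [ZpExtension.layer_unitTwist]
    exact ZpExtension.absClosureEmbedding_mem_layer_restrict _ K hsurj 1 ht
  refine ⟨⟨absClosureEmbedding ℚ K t, hmem⟩, Subtype.ext ?_⟩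
  change (absClosureEmbedding ℚ K t) ^ 2 = (2 : AlgebraicClosure K)
  rw [← map_pow, ht2, map_ofNat]

/-- **Odd `e(w|2)` ⟹ `w` ramifies in `K₁`**, for `4 ∤ [K:ℚ]` and `√2 ∉ K` (as the tree's `not_isUnramifiedIn_layer_one_of_odd_ramificationIdx`,
there `2 ∤ [K:ℚ]`): `e(Q|2) = e(w|2)·e(Q|w)` is even for `Q ∣ w` in `𝓞 K₁` since `√2 ∈ K₁`. [cite: Washington1997, §13.1] [cite: NeukirchANT1999, Ch. I §8] -/
theorem not_isUnramifiedIn_layer_one_of_odd_ramificationIdx_of_not_four_dvd (h4 : ¬ 4 ∣ Module.finrank ℚ K)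
    (h2 : ∀ x : K, x ^ 2 ≠ 2) (κ : ZpExtension K 2) (hκ : κ.IsCyclotomic) {w : HeightOneSpectrum (𝓞 K)}
    (hw : ((2 : ℕ) : 𝓞 K) ∈ w.asIdeal) (hodd : Odd (w.asIdeal.ramificationIdx ℤ)) :
    ¬ Algebra.IsUnramifiedIn (𝓞 (κ.layer 1)) w.asIdeal := by
  haveI : FiniteDimensional K (κ.layer 1) := κ.finiteDimensional_layer_holds 1
  haveI : NumberField (κ.layer 1) := NumberField.of_module_finite K _
  intro hunr
  obtain ⟨θ, hθ⟩ := exists_sq_eq_two_layer_one_of_forall_sq_ne_two h4 h2 κ hκ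
  haveI : w.asIdeal.IsPrime := w.isPrime
  haveI := liesOver_span_two_of_mem' w hw
  obtain ⟨⟨Q, hQprime, hQover⟩⟩ :=
    (inferInstance : Nonempty (Ideal.primesOver w.asIdeal (𝓞 (κ.layer 1))))
  haveI := hQprime
  haveI := hQover
  haveI : Q.LiesOver (Ideal.span {(2 : ℤ)}) := Ideal.LiesOver.trans Q w.asIdeal _
  have h1 : Q.ramificationIdx (𝓞 K) = 1 := hunr.ramificationIdx_eq_one hQover
  have heven := even_ramificationIdx_int_of_sq_eq_two hθ Q
  rw [Ideal.ramificationIdx_tower w.asIdeal Q, h1, mul_one] at heven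
  exact (Nat.not_even_iff_odd.mpr hodd) heven

/-- **Fukuda's index is `0` when `4 ∤ [K:ℚ]` and every prime above `2` has odd ramification index** (then `√2 ∉ K` automatically): every
cyclotomic `ℤ₂`-extension `κ` of `K` has `TotallyRamifiedFrom κ 0` — every prime of `ℤ̄_K` is unramified or TOTALLY ramified in `K_∞/K`.  Extends the
tree's `totallyRamifiedFrom_zero_of_forall_odd_ramificationIdx` (`2 ∤ [K:ℚ]`) to degrees `≡ 2 (mod 4)`, e.g. the `S₃`-sextics `ℚ(W[2])`.
[cite: Washington1997, §13.1 Lemma 13.3 (proof)] [cite: Fukuda1994, p. 264] -/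
theorem totallyRamifiedFrom_zero_of_forall_odd_ramificationIdx_of_not_four_dvd (h4 : ¬ 4 ∣ Module.finrank ℚ K)
    (κ : ZpExtension K 2) (hκ : κ.IsCyclotomic)
    (hodd : ∀ w : HeightOneSpectrum (𝓞 K), ((2 : ℕ) : 𝓞 K) ∈ w.asIdeal → Odd (w.asIdeal.ramificationIdx ℤ)) :
    TotallyRamifiedFrom κ 0 :=
  totallyRamifiedFrom_zero_of_forall_not_isUnramifiedIn_layer_one κ fun w hw =>
    not_isUnramifiedIn_layer_one_of_odd_ramificationIdx_of_not_four_dvd h4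
      (forall_sq_ne_two_of_forall_odd_ramificationIdx hodd) κ hκ hw (hodd w hw)

end Literature.NumberTheory.IwasawaTheory

end
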